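import Literature.MathematicalPhysics.QuantumFieldTheory.Balaban1983to89.B5Strip145Analytic
import Literature.MathematicalPhysics.QuantumFieldTheory.Balaban1983to89.B4ContourShift

/-!
# `Balaban1983to89.B5Strip145Decay` — the joiner: `k`-uniform exponential decay of the kernel of `(Q′G′²Q′*)⁻¹` (B5 (1.45))

T. Bałaban, *Propagators and renormalization transformations for lattice gauge theories. I*,
Commun. Math. Phys. **95**, 17–40 (1984) [Balaban1984PropagatorsI] (cell paper B5), p. 26 [PDF 10] (1.45) and p. 38 [PDF 22],
the sentence before (1.126); method of T. Bałaban, *Regularity and decay of lattice Green's functions*, Commun. Math. Phys.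
**89**, 571–597 (1983) [Balaban1983RegularityDecay] (cell paper B4 = B5's [2]), p. 586 [PDF 16] l. 9–15.

CITATION HEADER (lean-in-tree rule 2026-08-18).  This module is a SUPPLEMENT, not a quotation.  B5, p. 38 [PDF 22], the
sentence before (1.126), verbatim: *"They follow from the representation P = G′Q′*(Q′G′²Q′*)⁻¹Q′G′, from Lemma 2.4 of [2], and
the representation (1.45) and the analyticity method of proving an exponential decay (see the proof of Lemma 2.4 in [2])"*;
[2] = B4, p. 586 [PDF 16], verbatim: *"It is more troublesome, but equally elementary, to prove that this neighbourhood can be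
chosen independently of j and that the expression is bounded also in this neighbourhood. Shifting the domain of integration in
(2.49) into a complex domain in the direction of the vector x′ − y, we can bound the left hand side of (2.49) by a constant
depending on α multiplied by the exponential factor e^{−δ₀|x′−y|} = e^{−δ₀dist({x,x′},y)}."*  Neither paper writes the
argument for (1.45).  The cell supplies it in three kernel modules, all IMPORTED here untouched: `B5Strip145Leaves`
(`uniformStrip145_holds`: one complex strip, zero-free denominator `E` and `c ≤ |𝒩/E²| ≤ C`, for every `n = L^k` and
`a ∈ [a₋, a₊]`, hypothesis `0 < a₋` only), `B5Strip145Analytic` (joint holomorphy of `mReg = 𝒩/E²` on the fat region;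
`2π`-periodicity of `mReg` across the strip sides), and the generic contour-shift engine `B4ContourShift` of the surge seat pv17
(`StripRegular`, `stripRegular_inv`, `latticeKernel_decay`: a strip-regular multiplier bounded below by `c` has an inverse whose
lattice kernel is `≤ c⁻¹ e^{−κ|x|_∞}`).  THIS FILE IS THE ≈ 100-line JOINER announced in the cell journal (pv17 INTERFACE note
2026-08-18T18:24:03Z; claim C-B5-18-DECAY-JOINER):
* `differentiableAt_insertNth`, `tr_insertNth_left`, `insertNth_left_mem` — bookkeeping between the engine's slices
  `z ↦ insertNth i z q` / side points `insertNth i (∓π + iy) q` and the symbol modules' `Strip`, `tr`;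
* **`stripRegular_inverse145`** — for `0 ≤ κ ≤ r = rOf (d+1)`, `0 < c` and the strip data `E ≠ 0 ∧ c ≤ ‖mReg‖` on
  `Strip (d+1) κ`: `StripRegular (fun p => (mReg n a p)⁻¹) κ c⁻¹`;
* **`inverse145_kernel_decay (ha : 0 < a₋)`** — `∃ κ > 0, c > 0, ∀ n ≥ 1, ∀ a ∈ [a₋, a₊], ∀ x ∈ ℤ^{d+1}:
  ‖latticeKernel (fun p => (mReg n a p)⁻¹) x‖ ≤ c⁻¹ · e^{−κ |x|_∞}` (and `inverse145_kernel_decay_euclid`, rate `κ/√(d+1)` in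
  `|x|_2`), `latticeKernel G x = (2π)^{−(d+1)} ∫_{[−π,π]^{d+1}} G(p′) e^{ip′·x} dp′` being the unit-lattice kernel of the
  multiplier `G`: the `k`-UNIFORM exponential decay of the (infinite-volume) kernel of `(Q′_kG′_k²Q′_k*)⁻¹` is a THEOREM whose
  only hypothesis is `0 < a₋`.

NOT covered (stated so that no consumer over-reads this file): the finite-torus kernel on `T₁^{(k)}` actually used in B5 (a
Poisson periodisation of `latticeKernel`), the composition `P = G′Q′*(Q′G′²Q′*)⁻¹Q′G′` and the derivative `∂P∂*` of
(1.126)–(1.127), and B4's own (2.48)–(2.49) (fine-lattice kernels, multiplier sums (2.51)).  Value = kernel certificate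
(joiner) of a located by-reference step, NOT summit progress.  Unit b2b-balaban-b04-g3 (B04 cell, gen 3; B4 → B5 edge); staged
byte-identically under `HOME/lean/BalabanYm4/`.
-/

namespace Literature.MathematicalPhysics.QuantumFieldTheory.Balaban1983to89.B5Strip145Decay

open Complex Set
open Literature.MathematicalPhysics.QuantumFieldTheory.Balaban1983to89.B4Strip
open Literature.MathematicalPhysics.QuantumFieldTheory.Balaban1983to89.B4StripCauchy
open Literature.MathematicalPhysics.QuantumFieldTheory.Balaban1983to89.B5Strip145
open Literature.MathematicalPhysics.QuantumFieldTheory.Balaban1983to89.B5Strip145Leaves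
open Literature.MathematicalPhysics.QuantumFieldTheory.Balaban1983to89.B5Strip145Analytic
open Literature.MathematicalPhysics.QuantumFieldTheory.Balaban1983to89.B4ContourShift
open scoped Real

noncomputable section

variable {d : ℕ}

/-- the coordinate-insertion map `z ↦ insertNth i z c` is holomorphic (affine in `z`). [folklore] -/
theorem differentiableAt_insertNth (i : Fin (d + 1)) (c : Fin d → ℂ) (z : ℂ) :
    DifferentiableAt ℂ (fun w : ℂ => (i.insertNth w c : Fin (d + 1) → ℂ)) z := by
  refine differentiableAt_pi.2 (fun j => ?_)
  refine Fin.succAboveCases i ?_ ?_ j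
  · simp only [Fin.insertNth_apply_same]
    exact differentiableAt_id
  · intro k
    simp only [Fin.insertNth_apply_succAbove]
    exact differentiableAt_const _

/-- the `2π`-translate of the left side point `insertNth i (−π + iy) q` is the right side point `insertNth i (π + iy) q`.
[folklore] -/
theorem tr_insertNth_left (i : Fin (d + 1)) (y : ℝ) (q : Fin d → ℝ) :
    tr (i.insertNth (-π + y * I) (ofRealVec q)) i = i.insertNth (π + y * I) (ofRealVec q) := by
  rw [tr_def]
  funext j
  refine Fin.succAboveCases i ?_ ?_ j
  · simp only [Function.update_self, Fin.insertNth_apply_same]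
    ring
  · intro k
    rw [Function.update_of_ne (Fin.succAbove_ne i k), Fin.insertNth_apply_succAbove, Fin.insertNth_apply_succAbove]

/-- the left side point lies in the strip and has `Re p_i = −π`. [folklore] -/
theorem insertNth_left_mem {κ : ℝ} (hκ : 0 ≤ κ) (i : Fin (d + 1)) {q : Fin d → ℝ} (hq : q ∈ BZ d) {y : ℝ}
    (hy : |y| ≤ κ) : i.insertNth (-π + y * I) (ofRealVec q) ∈ Strip (d + 1) κ ∧
      ((i.insertNth (-π + y * I) (ofRealVec q) : Fin (d + 1) → ℂ) i).re = -π := by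
  refine ⟨insertNth_mem_Strip hκ i hq ?_, ?_⟩
  · refine ⟨?_, ?_⟩
    · simp [Real.pi_pos.le]
    · have : y ∈ Set.uIcc (-κ) κ := by
        rw [Set.uIcc_of_le (by linarith : -κ ≤ κ)]
        exact ⟨by linarith [neg_abs_le y], le_abs_self y |>.trans hy⟩
      simpa using this
  · simp [Fin.insertNth_apply_same]

/-- **STRIP REGULARITY OF THE MULTIPLIER (1.45)** in the sense of `B4ContourShift.StripRegular`, for its inverse: given the data of
`B5Strip145.UniformStrip145` on a strip of half-width `κ₁` with lower bound `c`, the inverse multiplier `1/mReg = E²/𝒩` is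
strip-regular on `Strip (d+1) κ`, `κ = min κ₁ r`, with bound `c⁻¹` — for EVERY `n ≥ 1` and every `a` the data covers. [folklore] -/
theorem stripRegular_inverse145 (n : ℕ) [NeZero n] (a : ℝ) {κ c : ℝ} (hκ0 : 0 ≤ κ) (hκr : κ ≤ rOf (d + 1))
    (hc : 0 < c) (h : ∀ p ∈ Strip (d + 1) κ, E n a 0 p ≠ 0 ∧ c ≤ ‖mReg n a p‖) :
    StripRegular (d := d) (fun p : Fin (d + 1) → ℂ => (mReg n a p)⁻¹) κ c⁻¹ := by
  obtain ⟨hκ1, hdκ⟩ := kappa_small hκ0 hκr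
  have hfat : Strip (d + 1) κ ⊆ Fat (d + 1) (rOf (d + 1)) := strip_subset_fat (rOf_pos _).le hκr
  have hdiffAt : ∀ p ∈ Strip (d + 1) κ, DifferentiableAt ℂ (mReg n a) p := fun p hp =>
    differentiableAt_mReg n a (rOf_le _) (d_mul_rOf_sq_le _) (hfat hp) (h p hp).1
  refine stripRegular_inv hκ0 hc ?_ ?_ ?_ (fun p hp => (h p hp).2)
  · exact fun p hp => (hdiffAt p hp).continuousAt.continuousWithinAt
  · intro i q hq z hz
    have hP : i.insertNth z (ofRealVec q) ∈ Strip (d + 1) κ :=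
      insertNth_mem_Strip hκ0 i hq (openRect_subset_closedRect κ hz)
    exact ((hdiffAt _ hP).comp z (differentiableAt_insertNth i _ z)).differentiableWithinAt
  · intro i q hq y hy
    obtain ⟨hP, hre⟩ := insertNth_left_mem hκ0 i hq hy
    rw [← tr_insertNth_left]
    exact (mReg_periodic_side n a hκ1 hdκ hP i hre).symm

/-- **THE `k`-UNIFORM EXPONENTIAL DECAY OF THE KERNEL OF `(Q′G′²Q′*)⁻¹` (B5 (1.45) p. 26; the decay asserted p. 38, the sentence
before (1.126), "from … the representation (1.45) and the analyticity method of proving an exponential decay"; method B4 p. 586).**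
For `0 < a₋ ≤ a₊` there are `κ > 0` and `c > 0` such that for EVERY `n = L^k ≥ 1`, every `a ∈ [a₋, a₊]` and every `x ∈ ℤ^{d+1}`:
`|K_{n,a}(x)| ≤ c⁻¹ e^{−κ |x|_∞}`, where `K_{n,a}(x) = (2π)^{−(d+1)} ∫_{[−π,π]^{d+1}} e^{ip′·x} / mReg_{n,a}(p′) dp′`
(`B4ContourShift.latticeKernel`) is the unit-lattice (infinite-volume torus `[−π,π]^{d+1}`) kernel of the Fourier multiplier
`1/mReg = E²/𝒩 = (Q′G′²Q′*)⁻¹(p′)`.  ONLY HYPOTHESIS: `0 < a₋`.  Assembled from `B5Strip145Leaves.uniformStrip145_holds` (the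
zero-free strip with `c ≤ |mReg| ≤ C`), `B5Strip145Analytic` (joint holomorphy, side periodicity) and the generic engine
`B4ContourShift.latticeKernel_inv_decay` (contour shift).  Not covered: the finite-torus (discrete `p′`) kernel actually used on
`T^{(k)}_1` (Poisson periodisation), and the composition `P = G′Q′*(Q′G′²Q′*)⁻¹Q′G′` of (1.126)–(1.127).
[cite: Balaban1984PropagatorsI, (1.45) p.26 and p.38 (the sentence before (1.126)); proof supplied by the audit, not printed] -/
theorem inverse145_kernel_decay (d : ℕ) (aminus aplus : ℝ) (ha : 0 < aminus) :
    ∃ κ c : ℝ, 0 < κ ∧ 0 < c ∧ ∀ (n : ℕ) [NeZero n] (a : ℝ), aminus ≤ a → a ≤ aplus →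
      ∀ x : Fin (d + 1) → ℤ,
        ‖latticeKernel (fun p => (mReg n a p)⁻¹) x‖ ≤ c⁻¹ * Real.exp (-(κ * supNorm x)) := by
  obtain ⟨κ₁, c, C, hκ₁, hc, h⟩ := uniformStrip145_holds (d + 1) aminus aplus ha
  refine ⟨min κ₁ (rOf (d + 1)), c, lt_min hκ₁ (rOf_pos _), hc, ?_⟩
  intro n _ a ha1 ha2 x
  have hκ0 : 0 ≤ min κ₁ (rOf (d + 1)) := (lt_min hκ₁ (rOf_pos _)).le
  have hsub : Strip (d + 1) (min κ₁ (rOf (d + 1))) ⊆ Strip (d + 1) κ₁ := strip_mono (min_le_left _ _)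
  have hreg := stripRegular_inverse145 n a hκ0 (min_le_right _ _) hc
    (fun p hp => ⟨(h n a ha1 ha2 p (hsub hp)).1, (h n a ha1 ha2 p (hsub hp)).2.1⟩)
  exact latticeKernel_decay hreg hκ0 x

/-- Euclidean form of the decay: `|K_{n,a}(x)| ≤ c⁻¹ e^{−(κ/√(d+1)) |x|_2}`. [cite: Balaban1984PropagatorsI, (1.45) p.26 and
p.38 (the sentence before (1.126)); proof supplied by the audit, not printed] -/
theorem inverse145_kernel_decay_euclid (d : ℕ) (aminus aplus : ℝ) (ha : 0 < aminus) :
    ∃ κ c : ℝ, 0 < κ ∧ 0 < c ∧ ∀ (n : ℕ) [NeZero n] (a : ℝ), aminus ≤ a → a ≤ aplus →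
      ∀ x : Fin (d + 1) → ℤ,
        ‖latticeKernel (fun p => (mReg n a p)⁻¹) x‖
          ≤ c⁻¹ * Real.exp (-(κ / Real.sqrt (d + 1) * Real.sqrt (∑ i, ((x i : ℝ)) ^ 2))) := by
  obtain ⟨κ₁, c, C, hκ₁, hc, h⟩ := uniformStrip145_holds (d + 1) aminus aplus ha
  refine ⟨min κ₁ (rOf (d + 1)), c, lt_min hκ₁ (rOf_pos _), hc, ?_⟩
  intro n _ a ha1 ha2 x
  have hκ0 : 0 ≤ min κ₁ (rOf (d + 1)) := (lt_min hκ₁ (rOf_pos _)).le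
  have hsub : Strip (d + 1) (min κ₁ (rOf (d + 1))) ⊆ Strip (d + 1) κ₁ := strip_mono (min_le_left _ _)
  have hreg := stripRegular_inverse145 n a hκ0 (min_le_right _ _) hc
    (fun p hp => ⟨(h n a ha1 ha2 p (hsub hp)).1, (h n a ha1 ha2 p (hsub hp)).2.1⟩)
  exact latticeKernel_decay_euclid hreg hκ0 (inv_pos.mpr hc).le x

end

end Literature.MathematicalPhysics.QuantumFieldTheory.Balaban1983to89.B5Strip145Decay
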